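import Mathlib
import Summits.NavierStokesRegularity.NavierStokesRegularity.Theorems.WakeRatchetTailRatchetDyadicLocalExistence
import Summits.NavierStokesRegularity.NavierStokesRegularity.Theorems.WakeRatchetTailRatchetDyadicUniqueness
import HarnessLib

/-!
# `WakeRatchet.TailRatchet` (stmt-NavierStokesRegularity-21808), door D4′ — Cauchy side:
# continuation, the MAXIMAL regular solution, and FINITE-TIME BLOW-UP of the non-negative dyadic lattice

Def-free support lemmas for the aside crux `TailRatchet` (route `WakeRatchet`).  MODEL lattice ODEs only
(the scalar dyadic / Katz–Pavlović chain `Ẋₙ = Λⁿ⁻¹ Xₙ₋₁² − Λⁿ Xₙ Xₙ₊₁` of Tao 2016 §1.2 / §4, `m = 1`);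
nothing in this file is a statement about the Navier–Stokes equations; stmt-21808 is neither proved nor
refuted here and no stub of skeleton d00b85951d7c is closed.

WHY.  This completes the «Cauchy theory» entry of the census of stmt-21808 (door D4′: non-negative
dyadic Cauchy blow-up → recentred frames → persistently firing eternal limit).  With local existence
(`dyadic_local_existence`), uniqueness (`dyadic_unique`), positivity (`dyadic_nonneg`) and the type-I
horizon (`time_of_regularity_le`) in the tree, we build:

* `dyadic_extend` — CONTINUATION: a solution on `(a, T)` regular with bound `B` on the whole interval
  extends to a regular solution on `(a, T + δ(B)/2)`, `δ(B) = 1/((Λ+Λ⁻¹)(B+1)² + 1)`, agreeing with the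
  old one on `(a, T)` (restart at `t₁ = max(T − δ/2, (a+T)/2)`, glue, identify by uniqueness).
* `dyadic_maximal` — THE MAXIMAL REGULAR SOLUTION under an a-priori horizon: if every regular solution
  through the datum lives on an interval of length `≤ T_b`, there are `T* ≤ T_b` and a solution `X*` on
  `(−δ₀, T*)` through the datum, regular on every `(−δ₀, T′)`, `T′ < T*`, along which
  `sup_n Λⁿ|X*ₙ(t)|` is UNBOUNDED on `(−δ₀, T*)` (blow-up alternative; `δ₀ = δ(R)` the local window).
* `dyadic_blowup` — FINITE-TIME BLOW-UP: for every `Λ > 1` and every non-negative datum with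
  `sup_n ΛⁿX⁰ₙ ≤ R` and one shell `X⁰_M > 0`, the maximal regular solution exists on `(−δ₀, T*)` with
  `δ₀ ≤ T* ≤ 2Λ²/((Λ−1)² Λᴹ X⁰_M)`, is non-negative on `[0, T*)`, obeys the type-I frame bound
  `ΛⁿXₙ(t)(T* − t) ≤ 2Λ²/(Λ−1)²` there, and `sup_n ΛⁿXₙ(t)` is unbounded as `t ↑ T*`
  (Katz–Pavlović 2005 / Kiselev–Zlatoš 2005 / Cheskidov 2008: blow-up of positive solutions; here
  kernel-checked for every `Λ > 1` in the scale-critical norm `sup_n Λⁿ|Xₙ|`).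

HONEST FRAMING: standard ODE continuation applied to a MODEL lattice plus the tree's type-I horizon; the
analytic inputs (M) per-shell action, (D) post-firing decay, (Q) pre-firing quietness and the extraction of
door D4′ are NOT addressed; rung 0.
-/

noncomputable section

set_option linter.dupNamespace false

namespace Summit.NavierStokesRegularity.NavierStokesRegularity.Theorems

namespace WakeRatchetDyadicCauchy

open Set Filter Topology Metric
open WakeRatchetDyadicPositivity

/-! ## Gluing two scalar solutions at a junction -/

/-- **Gluing at a junction.**  If `φ` has derivative `L` at `t₁`, `ψ` has right derivative `L` at
`t₁` within `[t₁, ∞)`, and `φ(t₁) = ψ(t₁)`, then `t ↦ if t ≤ t₁ then φ t else ψ t` has derivative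
`L` at `t₁`. [folklore] -/
theorem hasDerivAt_glue {φ ψ : ℝ → ℝ} {t₁ L : ℝ} (hφ : HasDerivAt φ L t₁)
    (hψ : HasDerivWithinAt ψ L (Ici t₁) t₁) (heq : φ t₁ = ψ t₁) :
    HasDerivAt (fun t => if t ≤ t₁ then φ t else ψ t) L t₁ := by
  have h1 : HasDerivWithinAt (fun t => if t ≤ t₁ then φ t else ψ t) L (Iic t₁) t₁ :=
    hφ.hasDerivWithinAt.congr (fun t (ht : t ≤ t₁) => by simp only [if_pos ht])
      (by simp only [if_pos le_rfl])
  have h2 : HasDerivWithinAt (fun t => if t ≤ t₁ then φ t else ψ t) L (Ici t₁) t₁ := by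
    refine hψ.congr (fun t (ht : t₁ ≤ t) => ?_) (by simp only [if_pos le_rfl, heq])
    by_cases h : t ≤ t₁
    · have : t = t₁ := le_antisymm h ht
      subst this
      simp only [if_pos le_rfl, heq]
    · simp only [if_neg h]
  have h := h1.union h2
  rwa [Iic_union_Ici, hasDerivWithinAt_univ] at h

/-! ## Continuation of a regular solution -/

section Continuation

variable {Λ : ℝ}

/-- **CONTINUATION.**  Let `Λ > 0` and let `X` solve the dyadic lattice on `(a, T)` (`a < T`) at every
shell, regular with `Λⁿ|Xₙ| ≤ B` on the whole of `(a, T)`.  Then there is a solution `X'` on the longer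
interval `(a, T + δ/2)`, `δ = 1/((Λ+Λ⁻¹)(B+1)² + 1)`, regular there with bound `B + 1`, which agrees
with `X` on `(a, T)`.  (Restart from the state at `t₁ = max(T − δ/2, (a+T)/2)` by
`dyadic_local_existence`, glue with `hasDerivAt_glue`, identify on `(a, T)` by `dyadic_unique`.)
[cite: Tao2016AveragedNS, §1.2, §4 Lemma 4.1 (4.8) with `m = 1`; Teschl2012 Cor. 2.15 (continuation)] -/
theorem dyadic_extend (hΛ : 0 < Λ) {X : ℤ → ℝ → ℝ} {a T B : ℝ} (haT : a < T)
    (hlaw : ∀ n : ℤ, ∀ t ∈ Ioo a T,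
      HasDerivAt (X n) (Λ ^ (n - 1) * X (n - 1) t ^ 2 - Λ ^ n * X n t * X (n + 1) t) t)
    (hreg : ∀ n : ℤ, ∀ t ∈ Ioo a T, |Λ ^ n * X n t| ≤ B) :
    ∃ X' : ℤ → ℝ → ℝ,
      (∀ n : ℤ, ∀ t ∈ Ioo a (T + 1 / ((Λ + Λ⁻¹) * (B + 1) ^ 2 + 1) / 2),
        HasDerivAt (X' n) (Λ ^ (n - 1) * X' (n - 1) t ^ 2 - Λ ^ n * X' n t * X' (n + 1) t) t) ∧
      (∀ n : ℤ, ∀ t ∈ Ioo a (T + 1 / ((Λ + Λ⁻¹) * (B + 1) ^ 2 + 1) / 2),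
        |Λ ^ n * X' n t| ≤ B + 1) ∧
      (∀ n : ℤ, ∀ t ∈ Ioo a T, X' n t = X n t) := by
  set δ : ℝ := 1 / ((Λ + Λ⁻¹) * (B + 1) ^ 2 + 1) with hδdef
  have hΛi : 0 < Λ⁻¹ := inv_pos.2 hΛ
  have hδ : 0 < δ := by positivity
  -- the restart time
  set t₁ : ℝ := max (T - δ / 2) ((a + T) / 2) with ht₁def
  have ht₁a : a < t₁ := lt_of_lt_of_le (by linarith) (le_max_right _ _)
  have ht₁T : t₁ < T := max_lt (by linarith) (by linarith)
  have ht₁ : t₁ ∈ Ioo a T := ⟨ht₁a, ht₁T⟩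
  have hTt₁ : T + δ / 2 ≤ t₁ + δ := by linarith [le_max_left (T - δ / 2) ((a + T) / 2)]
  have hB : 0 ≤ B := (abs_nonneg _).trans (hreg 0 t₁ ht₁)
  -- restart: local solution from the state at `t₁`, in the shifted time `s = t - t₁`
  obtain ⟨Y, hY0, hYlaw, hYreg⟩ :=
    dyadic_local_existence hΛ hB (X₀ := fun n => X n t₁) (fun n => hreg n t₁ ht₁)
  -- the glued family
  set X' : ℤ → ℝ → ℝ := fun n t => if t ≤ t₁ then X n t else Y n (t - t₁) with hX'def
  have hleft : ∀ n t, t ≤ t₁ → X' n t = X n t := fun n t ht => by simp only [hX'def, if_pos ht]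
  have hright : ∀ n t, ¬ t ≤ t₁ → X' n t = Y n (t - t₁) := fun n t ht => by
    simp only [hX'def, if_neg ht]
  have hjunction : ∀ n, Y n (t₁ - t₁) = X n t₁ := fun n => by rw [sub_self, hY0]
  -- the law on the extended interval
  have hlaw' : ∀ n : ℤ, ∀ t ∈ Ioo a (T + δ / 2),
      HasDerivAt (X' n) (Λ ^ (n - 1) * X' (n - 1) t ^ 2 - Λ ^ n * X' n t * X' (n + 1) t) t := by
    intro n t ht
    rcases lt_trichotomy t t₁ with hlt | heq | hgt
    · -- left of the junction: `X' = X` near `t`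
      have hev : X' n =ᶠ[𝓝 t] X n := by
        filter_upwards [Iio_mem_nhds hlt] with s hs using hleft n s (le_of_lt hs)
      rw [hleft n t hlt.le, hleft (n - 1) t hlt.le, hleft (n + 1) t hlt.le]
      exact (hlaw n t ⟨ht.1, hlt.trans ht₁T⟩).congr_of_eventuallyEq hev
    · -- at the junction: glue
      rw [heq, hleft n t₁ le_rfl, hleft (n - 1) t₁ le_rfl, hleft (n + 1) t₁ le_rfl]
      have hφ := hlaw n t₁ ht₁
      have h0mem : (t₁ - t₁) ∈ Ioo (-δ) δ := by rw [sub_self]; exact ⟨by linarith, hδ⟩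
      have hψ0 : HasDerivAt (fun s => Y n (s - t₁))
          (Λ ^ (n - 1) * Y (n - 1) (t₁ - t₁) ^ 2 - Λ ^ n * Y n (t₁ - t₁) * Y (n + 1) (t₁ - t₁)) t₁ :=
        HasDerivAt.comp_sub_const t₁ t₁ (hYlaw n (t₁ - t₁) h0mem)
      rw [hjunction, hjunction, hjunction] at hψ0
      exact hasDerivAt_glue hφ hψ0.hasDerivWithinAt (hjunction n).symm
    · -- right of the junction: `X' = Y(· - t₁)` near `t`
      have hev : X' n =ᶠ[𝓝 t] fun s => Y n (s - t₁) := by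
        filter_upwards [Ioi_mem_nhds hgt] with s hs using hright n s (not_le.2 hs)
      rw [hright n t (not_le.2 hgt), hright (n - 1) t (not_le.2 hgt), hright (n + 1) t (not_le.2 hgt)]
      have hmem : t - t₁ ∈ Ioo (-δ) δ := ⟨by linarith, by linarith [ht.2]⟩
      exact (HasDerivAt.comp_sub_const t t₁ (hYlaw n (t - t₁) hmem)).congr_of_eventuallyEq hev
  -- regularity on the extended interval
  have hreg'' : ∀ n : ℤ, ∀ t ∈ Ioo a (T + δ / 2), |Λ ^ n * X' n t| ≤ B + 1 := by
    intro n t ht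
    by_cases h : t ≤ t₁
    · rw [hleft n t h]
      exact (hreg n t ⟨ht.1, lt_of_le_of_lt h ht₁T⟩).trans (by linarith)
    · rw [hright n t h]
      exact hYreg n (t - t₁) ⟨by linarith [not_le.1 h], by linarith [ht.2]⟩
  have hTδ : T + 1 / ((Λ + Λ⁻¹) * (B + 1) ^ 2 + 1) / 2 = T + δ / 2 := by rw [hδdef]
  refine ⟨X', by rw [hTδ]; exact hlaw', by rw [hTδ]; exact hreg'', ?_⟩
  -- agreement on `(a, T)`: uniqueness from the common value at `t₁`
  have hlawT : ∀ n : ℤ, ∀ t ∈ Ioo a T,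
      HasDerivAt (X' n) (Λ ^ (n - 1) * X' (n - 1) t ^ 2 - Λ ^ n * X' n t * X' (n + 1) t) t :=
    fun n t ht => hlaw' n t ⟨ht.1, by linarith [ht.2]⟩
  have hregT : ∀ n : ℤ, ∀ t ∈ Ioo a T, |Λ ^ n * X' n t| ≤ B + 1 :=
    fun n t ht => hreg'' n t ⟨ht.1, by linarith [ht.2]⟩
  exact dyadic_unique hΛ hlawT hregT hlaw hreg ht₁ (fun n => hleft n t₁ le_rfl)

end Continuation


/-! ## The maximal regular solution under an a-priori horizon -/

section Maximal

variable {Λ : ℝ}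

/-- **THE MAXIMAL REGULAR SOLUTION (blow-up alternative) under an a-priori horizon.**  Let `Λ > 0`,
let the datum satisfy `Λⁿ|X⁰ₙ| ≤ R`, and put `δ₀ = 1/((Λ+Λ⁻¹)(R+1)² + 1)` (the local window of
`dyadic_local_existence`).  Suppose every solution through the datum on an interval `(−δ₀, T)`,
`T ≥ δ₀`, that is regular on the whole interval has `T ≤ T_b`.  Then there are `T* ∈ [δ₀, T_b]` and a
solution `X` on `(−δ₀, T*)` through the datum, regular on every `(−δ₀, T′)`, `T′ < T*` (and bounded by
`R + 1` on the initial window `(−δ₀, δ₀)`), along which `sup_n Λⁿ|Xₙ|` is UNBOUNDED on `(−δ₀, T*)`.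
(`T*` = the supremum of the lengths of regular solutions through the datum; they are pairwise
consistent by `dyadic_unique`, and a bounded maximal one would continue by `dyadic_extend`.)
[cite: Tao2016AveragedNS, §1.2, §4 Lemma 4.1 (4.8) with `m = 1`; Teschl2012 Cor. 2.15–2.16 (maximal solutions leave every bounded set)] -/
theorem dyadic_maximal (hΛ : 0 < Λ) {R : ℝ} (hR : 0 ≤ R) {X₀ : ℤ → ℝ}
    (hX₀ : ∀ n : ℤ, |Λ ^ n * X₀ n| ≤ R) {Tb : ℝ}
    (hTb : ∀ (T : ℝ) (X : ℤ → ℝ → ℝ) (B : ℝ), 1 / ((Λ + Λ⁻¹) * (R + 1) ^ 2 + 1) ≤ T →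
      (∀ n : ℤ, X n 0 = X₀ n) →
      (∀ n : ℤ, ∀ t ∈ Ioo (-(1 / ((Λ + Λ⁻¹) * (R + 1) ^ 2 + 1))) T,
        HasDerivAt (X n) (Λ ^ (n - 1) * X (n - 1) t ^ 2 - Λ ^ n * X n t * X (n + 1) t) t) →
      (∀ n : ℤ, ∀ t ∈ Ioo (-(1 / ((Λ + Λ⁻¹) * (R + 1) ^ 2 + 1))) T, |Λ ^ n * X n t| ≤ B) →
      T ≤ Tb) :
    ∃ Tstar : ℝ, 1 / ((Λ + Λ⁻¹) * (R + 1) ^ 2 + 1) ≤ Tstar ∧ Tstar ≤ Tb ∧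
    ∃ X : ℤ → ℝ → ℝ, (∀ n : ℤ, X n 0 = X₀ n) ∧
      (∀ n : ℤ, ∀ t ∈ Ioo (-(1 / ((Λ + Λ⁻¹) * (R + 1) ^ 2 + 1))) Tstar,
        HasDerivAt (X n) (Λ ^ (n - 1) * X (n - 1) t ^ 2 - Λ ^ n * X n t * X (n + 1) t) t) ∧
      (∀ T', T' < Tstar → ∃ B : ℝ, ∀ n : ℤ,
        ∀ t ∈ Ioo (-(1 / ((Λ + Λ⁻¹) * (R + 1) ^ 2 + 1))) T', |Λ ^ n * X n t| ≤ B) ∧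
      (∀ n : ℤ, ∀ t ∈ Ioo (-(1 / ((Λ + Λ⁻¹) * (R + 1) ^ 2 + 1)))
        (1 / ((Λ + Λ⁻¹) * (R + 1) ^ 2 + 1)), |Λ ^ n * X n t| ≤ R + 1) ∧
      (∀ B : ℝ, ∃ n : ℤ, ∃ t ∈ Ioo (-(1 / ((Λ + Λ⁻¹) * (R + 1) ^ 2 + 1))) Tstar,
        B < |Λ ^ n * X n t|) := by
  set δ₀ : ℝ := 1 / ((Λ + Λ⁻¹) * (R + 1) ^ 2 + 1) with hδ₀def
  have hΛi : 0 < Λ⁻¹ := inv_pos.2 hΛ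
  have hδ₀ : 0 < δ₀ := by positivity
  -- the set of lengths of regular solutions through the datum
  set S : Set ℝ := {T | δ₀ ≤ T ∧ ∃ (X : ℤ → ℝ → ℝ) (B : ℝ), (∀ n : ℤ, X n 0 = X₀ n) ∧
      (∀ n : ℤ, ∀ t ∈ Ioo (-δ₀) T,
        HasDerivAt (X n) (Λ ^ (n - 1) * X (n - 1) t ^ 2 - Λ ^ n * X n t * X (n + 1) t) t) ∧
      (∀ n : ℤ, ∀ t ∈ Ioo (-δ₀) T, |Λ ^ n * X n t| ≤ B)} with hSdef
  -- the local solution: `δ₀ ∈ S`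
  obtain ⟨Xl, hXl0, hXllaw, hXlreg⟩ := dyadic_local_existence hΛ hR hX₀
  have hS0 : δ₀ ∈ S :=
    ⟨le_rfl, Xl, R + 1, hXl0, hXllaw, fun n t ht => hXlreg n t (Ioo_subset_Icc_self ht)⟩
  have hSne : S.Nonempty := ⟨δ₀, hS0⟩
  have hSb : BddAbove S := ⟨Tb, fun T hT => by
    obtain ⟨hTδ, X, B, h0, hl, hb⟩ := hT; exact hTb T X B hTδ h0 hl hb⟩
  set Tstar : ℝ := sSup S with hTstar
  have hδT : δ₀ ≤ Tstar := le_csSup hSb hS0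
  have hTb' : Tstar ≤ Tb := csSup_le hSne fun T hT => by
    obtain ⟨hTδ, X, B, h0, hl, hb⟩ := hT; exact hTb T X B hTδ h0 hl hb
  -- a selection of solutions and their consistency
  have hsel : ∀ T ∈ S, ∃ (X : ℤ → ℝ → ℝ) (B : ℝ), (∀ n : ℤ, X n 0 = X₀ n) ∧
      (∀ n : ℤ, ∀ t ∈ Ioo (-δ₀) T,
        HasDerivAt (X n) (Λ ^ (n - 1) * X (n - 1) t ^ 2 - Λ ^ n * X n t * X (n + 1) t) t) ∧
      (∀ n : ℤ, ∀ t ∈ Ioo (-δ₀) T, |Λ ^ n * X n t| ≤ B) := fun T hT => hT.2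
  choose XT BT h0T hlawT hregT using hsel
  have hcons : ∀ (T₁ : ℝ) (h₁ : T₁ ∈ S) (T₂ : ℝ) (h₂ : T₂ ∈ S), ∀ n : ℤ,
      ∀ t ∈ Ioo (-δ₀) (min T₁ T₂), XT T₁ h₁ n t = XT T₂ h₂ n t := by
    intro T₁ h₁ T₂ h₂
    have hm0 : (0 : ℝ) ∈ Ioo (-δ₀) (min T₁ T₂) :=
      ⟨by linarith, lt_min (hδ₀.trans_le h₁.1) (hδ₀.trans_le h₂.1)⟩
    exact dyadic_unique hΛ (a := -δ₀) (T := min T₁ T₂)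
      (fun n t ht => hlawT T₁ h₁ n t ⟨ht.1, lt_of_lt_of_le ht.2 (min_le_left _ _)⟩)
      (fun n t ht => hregT T₁ h₁ n t ⟨ht.1, lt_of_lt_of_le ht.2 (min_le_left _ _)⟩)
      (fun n t ht => hlawT T₂ h₂ n t ⟨ht.1, lt_of_lt_of_le ht.2 (min_le_right _ _)⟩)
      (fun n t ht => hregT T₂ h₂ n t ⟨ht.1, lt_of_lt_of_le ht.2 (min_le_right _ _)⟩)
      hm0 (fun n => by rw [h0T T₁ h₁ n, h0T T₂ h₂ n])
  -- the maximal solution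
  classical
  set X : ℤ → ℝ → ℝ := fun n t =>
    if h : ∃ T, T ∈ S ∧ t < T then XT h.choose h.choose_spec.1 n t else 0 with hXdef
  have hloc : ∀ (T : ℝ) (hT : T ∈ S), ∀ n : ℤ, ∀ t ∈ Ioo (-δ₀) T, X n t = XT T hT n t := by
    intro T hT n t ht
    have h : ∃ T, T ∈ S ∧ t < T := ⟨T, hT, ht.2⟩
    have hX : X n t = XT h.choose h.choose_spec.1 n t := by simp only [hXdef, dif_pos h]
    rw [hX]
    exact hcons _ h.choose_spec.1 T hT n t ⟨ht.1, lt_min h.choose_spec.2 ht.2⟩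
  -- below `Tstar` there is always a longer member of `S`
  have hlonger : ∀ t, t < Tstar → ∃ T ∈ S, t < T := fun t ht => exists_lt_of_lt_csSup hSne ht
  refine ⟨Tstar, hδT, hTb', X, fun n => ?_, fun n t ht => ?_, fun T' hT' => ?_, fun n t ht => ?_, ?_⟩
  · -- initial values
    rw [hloc δ₀ hS0 n 0 ⟨by linarith, hδ₀⟩, h0T]
  · -- the law
    obtain ⟨T, hT, htT⟩ := hlonger t ht.2
    have hev : X n =ᶠ[𝓝 t] XT T hT n := by
      filter_upwards [Ioo_mem_nhds ht.1 htT] with s hs using hloc T hT n s hs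
    rw [hloc T hT n t ⟨ht.1, htT⟩, hloc T hT (n - 1) t ⟨ht.1, htT⟩, hloc T hT (n + 1) t ⟨ht.1, htT⟩]
    exact (hlawT T hT n t ⟨ht.1, htT⟩).congr_of_eventuallyEq hev
  · -- regular below `Tstar`
    obtain ⟨T, hT, hT'T⟩ := hlonger T' hT'
    refine ⟨BT T hT, fun n t ht => ?_⟩
    rw [hloc T hT n t ⟨ht.1, ht.2.trans hT'T⟩]
    exact hregT T hT n t ⟨ht.1, ht.2.trans hT'T⟩
  · -- the initial window: `X = Xl` there (uniqueness), and `Xl` is bounded by `R + 1`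
    rw [hloc δ₀ hS0 n t ht]
    have hu := dyadic_unique hΛ (hlawT δ₀ hS0) (hregT δ₀ hS0) hXllaw
      (fun n t ht => hXlreg n t (Ioo_subset_Icc_self ht)) (t₀ := 0) ⟨by linarith, hδ₀⟩
      (fun n => by rw [h0T, hXl0]) n t ht
    rw [hu]
    exact hXlreg n t (Ioo_subset_Icc_self ht)
  · -- blow-up alternative
    intro B
    by_contra hcon
    have hB : ∀ n : ℤ, ∀ t ∈ Ioo (-δ₀) Tstar, |Λ ^ n * X n t| ≤ B :=
      fun n t ht => not_lt.1 fun h => hcon ⟨n, t, ht, h⟩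
    have hlawX : ∀ n : ℤ, ∀ t ∈ Ioo (-δ₀) Tstar,
        HasDerivAt (X n) (Λ ^ (n - 1) * X (n - 1) t ^ 2 - Λ ^ n * X n t * X (n + 1) t) t := by
      intro n t ht
      obtain ⟨T, hT, htT⟩ := hlonger t ht.2
      have hev : X n =ᶠ[𝓝 t] XT T hT n := by
        filter_upwards [Ioo_mem_nhds ht.1 htT] with s hs using hloc T hT n s hs
      rw [hloc T hT n t ⟨ht.1, htT⟩, hloc T hT (n - 1) t ⟨ht.1, htT⟩, hloc T hT (n + 1) t ⟨ht.1, htT⟩]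
      exact (hlawT T hT n t ⟨ht.1, htT⟩).congr_of_eventuallyEq hev
    obtain ⟨X', hlaw', hreg', hagree⟩ :=
      dyadic_extend hΛ (by linarith : -δ₀ < Tstar) hlawX (fun n t ht => hB n t ht)
    set δ : ℝ := 1 / ((Λ + Λ⁻¹) * (B + 1) ^ 2 + 1) with hδdef
    have hδ : 0 < δ := by positivity
    have hmem : Tstar + δ / 2 ∈ S := by
      refine ⟨by linarith, X', B + 1, fun n => ?_, hlaw', hreg'⟩
      rw [hagree n 0 ⟨by linarith, hδ₀.trans_le hδT⟩, hloc δ₀ hS0 n 0 ⟨by linarith, hδ₀⟩, h0T]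
    have := le_csSup hSb hmem
    linarith

/-- **FINITE-TIME BLOW-UP OF THE NON-NEGATIVE DYADIC LATTICE (every `Λ > 1`).**  Let `Λ > 1` and let
the datum be non-negative with `sup_n ΛⁿX⁰ₙ ≤ R` and one shell `X⁰_M > 0`; put
`δ₀ = 1/((Λ+Λ⁻¹)(R+1)² + 1)`.  Then the maximal regular solution `X` through the datum lives on
`(−δ₀, T*)` with  `δ₀ ≤ T* ≤ 2Λ²/((Λ−1)² Λᴹ X⁰_M)`;  it is non-negative on `[0, T*)`, every frame
amplitude obeys the type-I bound `ΛⁿXₙ(t)(T* − t) ≤ 2Λ²/(Λ−1)²` on `[0, T*)`, it is regular on every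
`(−δ₀, T′)`, `T′ < T*`, and `sup_n ΛⁿXₙ(t)` is unbounded on `[0, T*)`: the scale-critical norm blows up
at the finite time `T*`.
[cite: Tao2016AveragedNS, §1.2 (finite time blow-up for the dyadic model: Katz–Pavlović, Cheskidov), §4 Lemma 4.1 (4.8) with `m = 1`; Teschl2012 Cor. 2.16] -/
theorem dyadic_blowup (hΛ : 1 < Λ) {R : ℝ} (hR : 0 ≤ R) {X₀ : ℤ → ℝ}
    (hX₀ : ∀ n : ℤ, |Λ ^ n * X₀ n| ≤ R) (hpos : ∀ n : ℤ, 0 ≤ X₀ n) {M : ℤ} (hM : 0 < X₀ M) :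
    ∃ Tstar : ℝ, 1 / ((Λ + Λ⁻¹) * (R + 1) ^ 2 + 1) ≤ Tstar ∧
      Tstar ≤ 2 * Λ ^ 2 / ((Λ - 1) ^ 2 * (Λ ^ M * X₀ M)) ∧
    ∃ X : ℤ → ℝ → ℝ, (∀ n : ℤ, X n 0 = X₀ n) ∧
      (∀ n : ℤ, ∀ t ∈ Ioo (-(1 / ((Λ + Λ⁻¹) * (R + 1) ^ 2 + 1))) Tstar,
        HasDerivAt (X n) (Λ ^ (n - 1) * X (n - 1) t ^ 2 - Λ ^ n * X n t * X (n + 1) t) t) ∧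
      (∀ T', T' < Tstar → ∃ B : ℝ, ∀ n : ℤ,
        ∀ t ∈ Ioo (-(1 / ((Λ + Λ⁻¹) * (R + 1) ^ 2 + 1))) T', |Λ ^ n * X n t| ≤ B) ∧
      (∀ n : ℤ, ∀ t ∈ Ico 0 Tstar, 0 ≤ X n t) ∧
      (∀ n : ℤ, ∀ t ∈ Ico 0 Tstar, Λ ^ n * X n t * (Tstar - t) ≤ 2 * Λ ^ 2 / (Λ - 1) ^ 2) ∧
      (∀ B : ℝ, ∃ n : ℤ, ∃ t ∈ Ico 0 Tstar, B < Λ ^ n * X n t) := by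
  have hΛ0 : 0 < Λ := by linarith
  set δ₀ : ℝ := 1 / ((Λ + Λ⁻¹) * (R + 1) ^ 2 + 1) with hδ₀def
  have hΛi : 0 < Λ⁻¹ := inv_pos.2 hΛ0
  have hδ₀ : 0 < δ₀ := by positivity
  -- the a-priori horizon from the positive shell `M`
  have hTb : ∀ (T : ℝ) (X : ℤ → ℝ → ℝ) (B : ℝ), δ₀ ≤ T → (∀ n : ℤ, X n 0 = X₀ n) →
      (∀ n : ℤ, ∀ t ∈ Ioo (-δ₀) T,
        HasDerivAt (X n) (Λ ^ (n - 1) * X (n - 1) t ^ 2 - Λ ^ n * X n t * X (n + 1) t) t) →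
      (∀ n : ℤ, ∀ t ∈ Ioo (-δ₀) T, |Λ ^ n * X n t| ≤ B) →
      T ≤ 2 * Λ ^ 2 / ((Λ - 1) ^ 2 * (Λ ^ M * X₀ M)) := by
    intro T X B hT h0 hl hb
    have h0mem : (0 : ℝ) ∈ Ioo (-δ₀) T := ⟨by linarith, hδ₀.trans_le hT⟩
    have h := time_of_regularity_le (N := M) hΛ (fun n _ => hl n)
      (fun T' hT' => ⟨B, fun n _ t ht => hb n t ⟨ht.1, ht.2.trans hT'⟩⟩) h0mem
      (fun n _ => by rw [h0 n]; exact hpos n) le_rfl (by rw [h0 M]; exact hM)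
    rw [h0 M] at h
    linarith
  obtain ⟨Tstar, hδT, hTb', X, h0, hlaw, hreg, hinit, hunb⟩ := dyadic_maximal hΛ0 hR hX₀ hTb
  have h0mem : (0 : ℝ) ∈ Ioo (-δ₀) Tstar := ⟨by linarith, hδ₀.trans_le hδT⟩
  have hnonneg : ∀ n : ℤ, ∀ t ∈ Ico 0 Tstar, 0 ≤ X n t := fun n t ht =>
    dyadic_nonneg (N := n) hΛ0.le (fun k _ => hlaw k) h0mem
      (fun k _ => by rw [h0 k]; exact hpos k) n le_rfl t ht
  refine ⟨Tstar, hδT, hTb', X, h0, hlaw, hreg, hnonneg, fun n t ht => ?_, fun B => ?_⟩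
  · have hreg' : ∀ T', T' < Tstar → ∃ B : ℝ, ∀ k : ℤ, n - 1 ≤ k →
        ∀ t ∈ Ioo (-δ₀) T', |Λ ^ k * X k t| ≤ B := fun T' hT' => by
      obtain ⟨B, hB⟩ := hreg T' hT'
      exact ⟨B, fun k _ => hB k⟩
    exact (frame_bound_of_nonneg_data (N := n) hΛ (fun k _ => hlaw k) hreg' h0mem
      (fun k _ => by rw [h0 k]; exact hpos k) le_rfl ht).2
  · obtain ⟨n, t, ht, hBt⟩ := hunb (max B (R + 1))
    have htδ : δ₀ ≤ t := by
      by_contra hlt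
      have := hinit n t ⟨ht.1, not_le.1 hlt⟩
      linarith [le_max_right B (R + 1)]
    have ht0 : t ∈ Ico 0 Tstar := ⟨hδ₀.le.trans htδ, ht.2⟩
    have hXnn : 0 ≤ Λ ^ n * X n t := mul_nonneg (zpow_pos hΛ0 n).le (hnonneg n t ht0)
    refine ⟨n, t, ht0, ?_⟩
    rw [abs_of_nonneg hXnn] at hBt
    exact lt_of_le_of_lt (le_max_left _ _) hBt

end Maximal

end WakeRatchetDyadicCauchy

end Summit.NavierStokesRegularity.NavierStokesRegularity.Theorems

end
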